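import Literature.NumberTheory.EllipticCurves.Kim2025.MainIdentityAtAugmentationOPEN
import Literature.NumberTheory.EllipticCurves.IwasawaLeadingTermOddPrime
import HarnessLib

/-!
# Kim 2025 (arXiv:2505.09121v1, PREPRINT), p0005:L44 «By computing `ord_π(δ^{min,k−r}_n)` for many
# `n`, we can verify (IMC at 𝟙) numerically» — what the identity at `𝟙` buys in the kernel: from ONE
# non-vanishing Kurihara number and ONE non-vanishing Taylor coefficient of `L_p(E,T)`, the order of
# vanishing `ord_{T=0} L_p(E,T) = rank E(ℚ)`, non-degeneracy of the canonical cyclotomic `p`-adic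
# height (Schneider) and finiteness of `Ш(E/ℚ)[p^∞]` — at every good ordinary `p ≥ 3` under large
# image (theorems only; inputs: the OPEN converse clause of Thm. 1.2 and the tree's published facts)

Topic `NumberTheory/EllipticCurves`, sub-directory `Kim2025`. Companion (theorems only: no definition,
no new named fact) of `MainIdentityAtAugmentationOPEN`. Cross-ladder literature-typing layer (cell
`bsd-littype`, seat 09, gen 3), answering the cell's OPEN-QUESTIONS-09 Q13 ("(IMC at 𝟙) as a road
to Schneider's non-degeneracy (I1) at `p = 3`") in the kernel. HONEST FRAMING: nothing is asserted;
every theorem is conditional on the hypotheses it names —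
* `h12c : Kim2025.thm12_mainIdentityAtAugmentation_of_kuriharaVanishingOrder_lt_top_OPEN` — the
  CONVERSE clause of [K25] Thm. 1.2 ("if `δ^{min,†}` does not vanish, then the Iwasawa main
  [identity] … localized at the augmentation ideal holds", §1.2.2 p0005:L35), UNREFEREED;
* `hKato : kato_divisibility` (Kato 2004 Thm. 17.4 (1): `X(E/ℚ_∞)` is `Λ`-torsion at a good
  ordinary odd `p`; tree named fact bsd.S20, REFEREED);
* `hS : Schneider1985_order_charGenerator_odd` (Perrin-Riou–Schneider as printed in
  Balakrishnan–Müller–Stein 2016 Thm. 1.7, `p > 2`; tree named fact, REFEREED):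
  `rank ≤ ord_T f_E`, and `ord_T f_E = rank ⟺` (height non-degenerate ∧ `Ш[p^∞]` finite);
and on two NUMERICAL inputs of the kind tabulated in [K25] App. A (Kim–Pollack): a non-vanishing
`Ω⁺_f`-normalised Kurihara number `kuriharaNumber f (p^k) n ψ ≠ 0` at a cyclic Kolyvagin level
`n ∈ 𝒩_k`, and the non-vanishing of the `rank E(ℚ)`-th Taylor coefficient of `L_p(E,T)`.

## The argument (all in the tree after `MainIdentityAtAugmentationOPEN`)

`δ̃_n ≠ 0` at a cyclic level ⟹ `ord(δ̃) < ⊤` (`kuriharaVanishingOrder_lt_top_of_kuriharaNumber_ne_zero`)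
⟹ [`h12c`] `length_{(T)} X(E/ℚ_∞) = ord_T L_p(E,T)` (`mainIdentityAtAugmentation`); `X` is finitely
generated (`SelmerDualData.module_finite_of_isCyclotomic`, theorem) and torsion [`hKato`], and
`char_Λ X = (f_E)` is principal (`charIdeal_isPrincipal_holds`, theorem), so
`length_{(T)} X = ord_T f_E` (`lengthAt_primeT_eq_order_of_charIdeal_eq_span`); hence
`ord_T f_E = ord_T L_p ≤ rank` (the given Taylor coefficient) while `rank ≤ ord_T f_E` [`hS` (1)];
so `ord_T f_E = rank = ord_T L_p(E,T)` and [`hS` (2)] the canonical `p`-adic height is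
non-degenerate and `Ш(E/ℚ)[p^∞]` is finite. At `p ≥ 5` the same conclusions follow WITHOUT [K25]
from Burungale–Castella–Skinner 2025 Thm. 1.1.2 (a) (`order_padicLFunction_eq_order_charGenerator`,
file `PAdicLFunctionOrderTransferRankOneProofs`); the point of this file is `p = 3` (and `p ≥ 5` off
any main-conjecture input), where [K25]'s numerics replace the main conjecture.

References: C.-H. Kim (app. with R. Pollack), arXiv:2505.09121v1, Thm. 1.2 and p0005:L44, App. A.1.5
[Kim2025RefinedTNC]; K. Kato, Astérisque 295 (2004) Thm. 17.4 [Kato2004Asterisque]; J. Balakrishnan,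
J. S. Müller, W. Stein, Math. Comp. 85 (2016) Thm. 1.7 [BalakrishnanMullerStein2015]; P. Schneider,
Invent. Math. 79 (1985) [Schneider1985]; B. Perrin-Riou, Invent. Math. 109 (1992) §3.4
[PerrinRiou1992].
-/

noncomputable section

open scoped MatrixGroups ModularForm Classical

open CongruenceSubgroup WeierstrassCurve Literature.NumberTheory.EllipticCurves.ModularForms
  Literature.NumberTheory.EllipticCurves Literature.NumberTheory.EllipticCurves.Module
  Literature.NumberTheory.EllipticCurves.IwasawaAlgebra

namespace Literature.NumberTheory.EllipticCurves.Kim2025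

variable (W : WeierstrassCurve ℚ) [W.IsElliptic] [W.IsGloballyMinimal] (p : ℕ) [Fact p.Prime]
  {N : ℕ} [NeZero N] (f : CuspForm (Gamma0 N) 2)

omit [W.IsElliptic] [NeZero N] in
/-- **The identity at `𝟙` pins the order of the characteristic power series: `ord_T f_E =
ord_{T=0} L_p(E,T)`** for `X(E/ℚ_∞)` finitely generated torsion with `char_Λ X = (f_E)`.
[cite: Kim2025RefinedTNC, statement 3.17 at the augmentation ideal (§3.5.3, chunk p0014:L43–L51)]
[cite: Washington1997, §13.2] -/
theorem order_charGenerator_eq_order_padicLFunction_of_mainIdentityAtAugmentation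
    {κ : ZpExtension ℚ p} {γ : Field.absoluteGaloisGroup ℚ} (D : W.SelmerDualData κ γ)
    [Module.Finite (IwasawaAlgebra p) D.X] (hX : D.IsTorsion) {fE : IwasawaAlgebra p}
    (hfE : D.charIdeal = Ideal.span {fE}) (hid : mainIdentityAtAugmentation W p f D) :
    fE.order = (padicLFunction f (unitRoot W p : ℚ_[p])).order := by
  rw [← lengthAt_primeT_eq_order_of_charIdeal_eq_span hX hfE]
  exact hid

omit [W.IsElliptic] [NeZero N] in
/-- A non-vanishing `r`-th Taylor coefficient bounds the order of vanishing: `ord_{T=0} L_p(E,T) ≤ r`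
(the numerical input "`[T^r] L_p(E,T) ≠ 0`" of a `p`-adic BSD computation).
[cite: MazurTateTeitelbaum1986Invent, §I.13 (the T-expansion of L_p)] -/
theorem order_padicLFunction_le_of_coeff_ne_zero {r : ℕ}
    (hcoeff : PowerSeries.coeff r (padicLFunction f (unitRoot W p : ℚ_[p])) ≠ 0) :
    (padicLFunction f (unitRoot W p : ℚ_[p])).order ≤ r :=
  PowerSeries.order_le r hcoeff

/-- **Kim–Pollack numerics ⟹ `ord_{T=0} L_p(E,T) = ord_T f_E = rank E(ℚ)`, the canonical `p`-adic
height is non-degenerate and `Ш(E/ℚ)[p^∞]` is finite — at every good ordinary `p ≥ 3` under large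
image, GRANTED the converse clause of [K25] Thm. 1.2 (`h12c`, OPEN), Kato's torsion theorem
(`hKato`) and Perrin-Riou–Schneider (`hS`).** Inputs: `W/ℚ` globally minimal elliptic; `p ≥ 3` good
ordinary with `ρ̄_{E,p^n}` onto for all `n`; the newform `f` with `Ω⁺_f` an integral period; a
non-vanishing Kurihara number `kuriharaNumber f (p^k) n ψ ≠ 0` at a CYCLIC Kolyvagin level
`n ∈ 𝒩_k` (surjective `ψ`); and `[T^{rank E(ℚ)}] L_p(E,T) ≠ 0`. Conclusion, for the cyclotomic
`(κ, γ)` in the cyclotomic variable, any Pontryagin-dual datum `D` with `char_Λ X = (f_E)`, and THE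
canonical height `Dh`: `ord_T f_E = rank`, `ord_{T=0} L_p(E,T) = rank`, `Reg_p(E, Dh) ≠ 0`,
`Ш(E/ℚ)[p^∞]` finite. ("By computing `ord_π(δ^{min}_n)` for many `n`, we can verify (IMC at 𝟙)
numerically" — and (IMC at 𝟙) is what turns the analytic order into the algebraic one.)
[cite: Kim2025RefinedTNC, Thm. 1.2 converse clause and p0005:L44 (§1.2.2, chunk p0005:L35–L44), App. A.1.5 (chunk p0027:L28–L80) (ANNOUNCED; `h12c` is an OPEN Prop)]
[cite: BalakrishnanMullerStein2015, Thm. 1.7] [cite: Kato2004Asterisque, Thm. 17.4 (1) (p. 273)] -/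
theorem order_eq_rank_and_schneider_of_kuriharaNumber_ne_zero_of_OPEN
    (h12c : thm12_mainIdentityAtAugmentation_of_kuriharaVanishingOrder_lt_top_OPEN)
    (hKato : ∀ (κ : ZpExtension ℚ p) (γ : Field.absoluteGaloisGroup ℚ),
      kato_divisibility W p (κ := κ) (γ := γ) (f := f))
    (hS : Schneider1985_order_charGenerator_odd)
    (hp : 3 ≤ p) (htower : ∀ n : ℕ, W.HasSurjectiveModNGaloisRep (p ^ n : ℕ))
    (hord : IsOrdinaryAt W p) (hf : IsNewformOf W f)
    (hint : ∀ r : ℚ, ratPlusSymbol f r ≠ 0 → 0 ≤ padicValRat p (ratPlusSymbol f r))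
    {k n : ℕ} [NeZero n] (hcyc : IsCyclicKolyvaginLevel W p n)
    (hn : Kato.IsKolyvaginProduct W p k n)
    (ψ : (ℓ : ℕ) → (ZMod ℓ)ˣ →* Multiplicative (ZMod (p ^ k)))
    (hψ : ∀ ℓ ∈ n.primeFactors, Function.Surjective (ψ ℓ))
    (hne : kuriharaNumber f (p ^ k) n ψ ≠ 0)
    (hcoeff : PowerSeries.coeff W.mordellWeilRank (padicLFunction f (unitRoot W p : ℚ_[p])) ≠ 0)
    {κ : ZpExtension ℚ p} {γ : Field.absoluteGaloisGroup ℚ} (hκ : κ.IsCyclotomic)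
    (hγ : κ.IsTopGenerator γ) (hγ' : IsCyclotomicVariable p γ) (D : W.SelmerDualData κ γ)
    {fE : IwasawaAlgebra p} (hfE : D.charIdeal = Ideal.span {fE})
    (Dh : PAdicHeightData W p) (hDh : Dh.IsCanonical) :
    fE.order = W.mordellWeilRank ∧
      (padicLFunction f (unitRoot W p : ℚ_[p])).order = W.mordellWeilRank ∧
      SchneiderConjecture Dh ∧ Finite (AddCommGroup.primaryComponent W.sha p) := by
  have hp2 : p ≠ 2 := by omega
  have hgood : W.HasGoodReductionAtPrime p := ((isOrdinaryAt_iff W p).1 hord).1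
  have hap : ¬ (p : ℤ) ∣ W.frobeniusTrace p := ((isOrdinaryAt_iff W p).1 hord).2
  -- `X` finitely generated (theorem) and torsion (Kato 17.4 (1))
  haveI : Module.Finite (IwasawaAlgebra p) D.X :=
    (WeierstrassCurve.SelmerDualData.module_finite_of_isCyclotomic (W := W) (κ := κ) hκ D) hγ
  have hX : D.IsTorsion := (hKato κ γ hp2 hord hκ hγ hγ' hf D).1
  -- the identity at `𝟙` from the Kurihara unit (K25 converse clause)
  have hid : mainIdentityAtAugmentation W p f D :=
    mainIdentityAtAugmentation_of_kuriharaNumber_ne_zero_of_OPEN W p f h12c hp htower hord hf hint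
      hcyc hn ψ hψ hne hκ hγ hγ' D
  have hfo : fE.order = (padicLFunction f (unitRoot W p : ℚ_[p])).order :=
    order_charGenerator_eq_order_padicLFunction_of_mainIdentityAtAugmentation W p f D hX hfE hid
  -- squeeze: `rank ≤ ord_T f_E = ord_T L_p ≤ rank`
  obtain ⟨hle, hiff, -⟩ := hS W p hp2 hgood hap κ γ hκ hγ hγ' D hX fE hfE Dh hDh
  have hle' : (padicLFunction f (unitRoot W p : ℚ_[p])).order ≤ W.mordellWeilRank :=
    order_padicLFunction_le_of_coeff_ne_zero W p f hcoeff
  have heq : fE.order = W.mordellWeilRank := le_antisymm (hfo ▸ hle') hle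
  exact ⟨heq, hfo ▸ heq, (hiff.mp heq).1, (hiff.mp heq).2⟩

/-- **The same, quantifier-free in the Iwasawa data: Schneider non-degeneracy and `Ш(E/ℚ)[p^∞]`
finite from the numerics** (the cyclotomic `(κ, γ)`, a dual datum `D` and a generator `f_E` of its
characteristic ideal EXIST by the tree theorems
`exists_isCyclotomic_isTopGenerator_isCyclotomicVariable_holds`, `nonempty_selmerDualData_holds`,
`charIdeal_isPrincipal_holds`). This is OPEN-QUESTIONS-09 Q13 in the kernel: per pair `(E, p)`,
two finite computations + [K25]'s converse clause give the programme's open question I1 at `p`.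
[cite: Kim2025RefinedTNC, Thm. 1.2 converse clause and p0005:L44 (§1.2.2) (ANNOUNCED; `h12c` is an OPEN Prop)]
[cite: BalakrishnanMullerStein2015, Thm. 1.7] [cite: Kato2004Asterisque, Thm. 17.4 (1) (p. 273)] -/
theorem schneider_and_finite_sha_of_kuriharaNumber_ne_zero_of_OPEN
    (h12c : thm12_mainIdentityAtAugmentation_of_kuriharaVanishingOrder_lt_top_OPEN)
    (hKato : ∀ (κ : ZpExtension ℚ p) (γ : Field.absoluteGaloisGroup ℚ),
      kato_divisibility W p (κ := κ) (γ := γ) (f := f))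
    (hS : Schneider1985_order_charGenerator_odd)
    (hp : 3 ≤ p) (htower : ∀ n : ℕ, W.HasSurjectiveModNGaloisRep (p ^ n : ℕ))
    (hord : IsOrdinaryAt W p) (hf : IsNewformOf W f)
    (hint : ∀ r : ℚ, ratPlusSymbol f r ≠ 0 → 0 ≤ padicValRat p (ratPlusSymbol f r))
    {k n : ℕ} [NeZero n] (hcyc : IsCyclicKolyvaginLevel W p n)
    (hn : Kato.IsKolyvaginProduct W p k n)
    (ψ : (ℓ : ℕ) → (ZMod ℓ)ˣ →* Multiplicative (ZMod (p ^ k)))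
    (hψ : ∀ ℓ ∈ n.primeFactors, Function.Surjective (ψ ℓ))
    (hne : kuriharaNumber f (p ^ k) n ψ ≠ 0)
    (hcoeff : PowerSeries.coeff W.mordellWeilRank (padicLFunction f (unitRoot W p : ℚ_[p])) ≠ 0)
    (Dh : PAdicHeightData W p) (hDh : Dh.IsCanonical) :
    (padicLFunction f (unitRoot W p : ℚ_[p])).order = W.mordellWeilRank ∧
      SchneiderConjecture Dh ∧ Finite (AddCommGroup.primaryComponent W.sha p) := by
  obtain ⟨κ, hκ, γ, hγ, hγ'⟩ := exists_isCyclotomic_isTopGenerator_isCyclotomicVariable_holds p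
  obtain ⟨D⟩ := W.nonempty_selmerDualData_holds κ γ hγ
  haveI : (Module.charIdeal (IwasawaAlgebra p) D.X).IsPrincipal := charIdeal_isPrincipal_holds p D.X
  obtain ⟨fE, hfE⟩ :=
    Submodule.IsPrincipal.principal (Module.charIdeal (IwasawaAlgebra p) D.X)
  have hfE' : D.charIdeal = Ideal.span {fE} := hfE
  obtain ⟨-, h2, h3, h4⟩ := order_eq_rank_and_schneider_of_kuriharaNumber_ne_zero_of_OPEN W p f h12c
    hKato hS hp htower hord hf hint hcyc hn ψ hψ hne hcoeff hκ hγ hγ' D hfE' Dh hDh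
  exact ⟨h2, h3, h4⟩

end Literature.NumberTheory.EllipticCurves.Kim2025

end
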